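import Summits.HodgeConjecture.CorCM.Model.CMDominationOfRiemann
import Summits.HodgeConjecture.CorCM.AndreProductFormHolds
import Summits.HodgeConjecture.CorCM.Interfaces
import Literature.AlgebraicGeometry.HodgeTheory.WeilClassesCMReductionGalois
import Literature.AlgebraicGeometry.HodgeTheory.HodgeClassesIsogenyInvariance
import HarnessLib

/-!
# COR-CM (cell `pub-hodgecm2`): Milne 2020, Theorem 1 (= André 1992) for an ARBITRARY complex abelian
# variety of CM type — a kernel theorem modulo Riemann's theorem (row B02) and the records `hU`, `h₃`

HONEST FRAMING. A STRUCTURE theorem about the Hodge ring of a complex abelian variety of CM type; no case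
of the Hodge conjecture is proved. The Literature record
`HodgeTheory.Milne2020_hodgeClasses_cmType_mem_span_pullback_weilClassesField_galois` (binder table
`HOME/lit/milne.md` row M15; Milne, arXiv:2010.08857, §3 Thm. 1 [André 1992] with its proof) is DERIVED
from the three DISPLAYED binders of the cell's top statement `HC_CM_of_PerLFace`: Riemann's theorem
`hR : DeligneMilne1982_Thm_6_20_full` (row B02) and the records `hU : BallQuotientUniformisedDatum`,
`h₃ : CMAbelianVarietyRealised` (∀-parameters) — `milne2020_thm1_of_riemann`. No named fact (D-0026).

## The printed proof and its kernel pieces (Milne 2020, proof of Thm. 1)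

* «We may suppose that `A` is a product … Let `F` be a CM subfield of `ℂ`, Galois over `ℚ`, splitting
  the centre of `End⁰(A)`.» — KERNEL modulo `hR`: every complex abelian variety of CM type is DOMINATED
  (`π ∘ s = [N]`, `N ≠ 0`) by a product `∏_{j ≤ n} A_{(F,Θ_j)}` of chosen realisations over ONE Galois CM
  field `F` (`Domination.cmDominated_of_isOfCMType_all_of_riemann`, seat b18: Shimura–Taniyama via
  `thm2_cor_of_riemann` / `thm3_isogenousPower_of_riemann`, Poincaré). Added here: the bridge from the
  left-nested `cmProdAV` to the biproduct `⨁_j A_{(F,Θ_j)}` (`cmProdAV_dominatedBy_biproduct`), and the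
  factors read as realisations of CM types of `F` (`IsCMTypeRealisation.transport` along `F ≃ (cmCode F Θ_j).E`).
* «`A_Δ := ∏_{s ∈ Δ} A_s` … of split Weil type relative to `F` … the subspaces `f_Δ^*(W_F(A_Δ))` span
  `B^p`.» — for the PRODUCT this is the kernel theorem
  `AndreProductForm.andre1992_hodgeClasses_cmTypedProduct_mem_span_pullback_weilLines_holds` (seat
  lit-andre gen 2); it is moved to `A` through the domination: `s^*(π^* c) = N^{2p} c`
  (`complexBetti_map_map_of_comp_eq_nsmul_id`) and `s^* ∘ f_Δ^* = (s ≫ f_Δ)^*`.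
* «relative to `F`» on the record's carriers `weilClassesField B ψ P (2p)`: `F = ℚ(a₀)` for an INTEGER
  `a₀` separating the complex embeddings, `ψ :=` the diagonal action of `a₀`, `P := minpoly_ℤ(a₀)`
  (`AndreProductForm.exists_integer_separating`, `minpoly_facts`); the `F`-Weil lines lie in `W_F ⊗ ℂ`
  (`weilLineClasses_le_weilClassesField`), and `P` is a GALOIS CM FIELD POLYNOMIAL in the record's sense
  (`isGaloisCMFieldPoly_minpoly`: no real root as `F` is totally complex; complex conjugation induced by
  one `Q ∈ ℚ[T]` as `c(a₀) ∈ ℚ(a₀)`; every root a `ℚ`-polynomial in every other as `F/ℚ` is Galois).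

Consequences: `hc_cm_of_weilClassesField_galois_of_riemann` (`HC_CM` from `hR`, `hU`, `h₃` and the
algebraicity of the rational `(p,p)` classes of `weilClassesField B ψ P (2p)` for every Galois CM field
polynomial, every `F`-rank); `…_of_hazama` (rank four, modulo Hazama's record). Versions WITHOUT `hU`:
`CorCM/Milne2020OfRiemannRealised.lean` (via `milne2020_of_avDominatedBy`).

References: [Milne2020HodgeClassesAV] §1–§3, Thm. 1 and proof; [Andre1992HodgeCM] Théorème;
[Deligne1982HodgeCycles] §4 Prop. 4.4, §5, endnote M.12; [DeligneMilne1982Tannakian] Thm. 6.20 (Riemann);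
[Shimura1998] §6.1 Cor. of Thm. 2, §6.2 Thm. 3; [MoonenZarhin1998WeilClasses] §1;
[Milne2007TateFiniteFieldsAIM] Thm. 8.5; [Hazama2003GHCCM] Thm. 8.3.
-/

noncomputable section

namespace Summit.HodgeConjecture.CorCM.Milne2020

open CategoryTheory CategoryTheory.Limits NumberField Polynomial
open Literature.AlgebraicGeometry Literature.AlgebraicGeometry.Motives Literature.AlgebraicGeometry.HodgeTheory
open Literature.AlgebraicGeometry.ComplexMultiplication Literature.AlgebraicGeometry.Milne1999
open Literature.NumberTheory.Automorphic
open Literature.NumberTheory.Automorphic.PicardCM (CMCode cmRealisation BallQuotientUniformisedDatum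
  CMAbelianVarietyRealised)
open Summit.HodgeConjecture.CorCM.Domination
open Summit.HodgeConjecture.CorCM.AndreProductForm

/-- A family indexed by `Fin 1`: the factor `X 0` is `1`-dominated by `⨁ X` (`ι₀ ≫ π₀ = 𝟙`). [folklore] -/
theorem avDominatedBy_biproduct_fin_one (X : Fin 1 → AbelianVariety ℂ) : AVDominatedBy (X 0) (⨁ X) :=
  ⟨biproduct.ι X 0, biproduct.π X 0, 1, one_ne_zero, by rw [biproduct.ι_π_self, one_smul]⟩

/-- Appending the last factor: `(⨁_{j ≤ n} X_j) × X_{n+1}` is `1`-dominated by `⨁_{j ≤ n+1} X_j` (the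
obvious comparison homomorphisms compose to the identity). [folklore] -/
theorem avDominatedBy_biproduct_snoc {n : ℕ} (X : Fin (n + 2) → AbelianVariety ℂ) :
    AVDominatedBy ((⨁ fun j : Fin (n + 1) => X j.castSucc).prod (X (Fin.last (n + 1)))) (⨁ X) := by
  refine ⟨biproduct.lift fun j => Fin.lastCases
        (motive := fun j => ((⨁ fun j : Fin (n + 1) => X j.castSucc).prod (X (Fin.last (n + 1))) ⟶ X j))
        (AbelianVariety.snd _ _) (fun j' => AbelianVariety.fst _ _ ≫ biproduct.π _ j') j,
      AbelianVariety.prodLift (biproduct.lift fun j' : Fin (n + 1) => biproduct.π X j'.castSucc)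
        (biproduct.π X (Fin.last (n + 1))),
      1, one_ne_zero, ?_⟩
  rw [one_smul]
  apply AbelianVariety.prod_hom_ext
  · rw [Category.assoc, AbelianVariety.prodLift_fst, Category.id_comp]
    apply biproduct.hom_ext
    intro j'
    rw [Category.assoc, biproduct.lift_π, biproduct.lift_π, Fin.lastCases_castSucc]
  · rw [Category.assoc, AbelianVariety.prodLift_snd, Category.id_comp, biproduct.lift_π,
      Fin.lastCases_last]

/-- **The left-nested product `cmProdAV F h₃ n Θ = ∏_{j ≤ n} A_{(F,Θ_j)}` is dominated by the biproduct
`⨁_{j ≤ n} A_{(F,Θ_j)}` of the same chosen realisations** (in fact isomorphic; domination is all the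
assembly needs). By induction over the nesting, `avDominatedBy_biproduct_snoc` and `AVDominatedBy.prod`.
[folklore] -/
theorem cmProdAV_dominatedBy_biproduct (F : Type) [Field F] [NumberField F] [IsCMField F]
    (h₃ : CMAbelianVarietyRealised) :
    ∀ (n : ℕ) (Θ : Fin (n + 1) → CMType F),
      AVDominatedBy (cmProdAV F h₃ n Θ) (⨁ fun j => (cmRealisation h₃ (cmCode F (Θ j))).AV)
  | 0, Θ => by
      rw [cmProdAV_zero]
      exact avDominatedBy_biproduct_fin_one fun j => (cmRealisation h₃ (cmCode F (Θ j))).AV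
  | n + 1, Θ => by
      rw [cmProdAV_succ]
      exact ((cmProdAV_dominatedBy_biproduct F h₃ n fun i => Θ i.castSucc).prod
          (AVDominatedBy.refl _)).trans
        (avDominatedBy_biproduct_snoc fun j => (cmRealisation h₃ (cmCode F (Θ j))).AV)

section GaloisCMPoly

variable (K : Type) [Field K] [NumberField K]

/-- `minpoly_ℤ(a₀)` maps to `minpoly_ℚ(a₀)` (integrally closed base). [folklore] -/
theorem minpoly_int_map_eq (a₀ : 𝓞 K) :
    (minpoly ℤ a₀).map (Int.castRingHom ℚ) = minpoly ℚ (a₀ : K) := by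
  have hintK : IsIntegral ℤ (a₀ : K) := RingOfIntegers.isIntegral_coe a₀
  have heq : minpoly ℤ (a₀ : K) = minpoly ℤ a₀ :=
    minpoly.algebraMap_eq (IsFractionRing.injective (𝓞 K) K) a₀
  rw [← heq, ← algebraMap_int_eq, ← minpoly.isIntegrallyClosed_eq_field_fractions' ℚ hintK]

/-- Every complex root of `minpoly_ℤ(a₀)` is `σ(a₀)` for a complex embedding `σ` of `K`. [folklore] -/
theorem exists_embedding_of_root (a₀ : 𝓞 K) {ρ : ℂ}
    (hρ : Polynomial.eval₂ (Int.castRingHom ℂ) ρ (minpoly ℤ a₀) = 0) :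
    ∃ σ : K →+* ℂ, σ (a₀ : K) = ρ := by
  have hmem : ρ ∈ (minpoly ℚ (a₀ : K)).rootSet ℂ := by
    rw [Polynomial.mem_rootSet]
    refine ⟨minpoly.ne_zero (Algebra.IsIntegral.isIntegral (R := ℚ) (a₀ : K)), ?_⟩
    have h2 : Polynomial.eval₂ (Int.castRingHom ℂ) ρ (minpoly ℤ a₀) =
        Polynomial.aeval ρ ((minpoly ℤ a₀).map (Int.castRingHom ℚ)) := by
      rw [Polynomial.aeval_def, Polynomial.eval₂_map]
      congr 1
    rw [← minpoly_int_map_eq, ← h2, hρ]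
  rw [← NumberField.Embeddings.range_eval_eq_rootSet_minpoly K ℂ (a₀ : K)] at hmem
  exact hmem

/-- A separating element generates `K` over `ℚ`: every element of `K` is a `ℚ`-polynomial in `a₀`.
[folklore] -/
theorem exists_aeval_eq_of_separating (a₀ : 𝓞 K)
    (hsep : Function.Injective fun σ : K →+* ℂ => σ (a₀ : K)) (x : K) :
    ∃ R : Polynomial ℚ, Polynomial.aeval (a₀ : K) R = x := by
  have hprim : IntermediateField.adjoin ℚ {(a₀ : K)} = ⊤ := by
    rw [Field.primitive_element_iff_algHom_eq_of_eval' ℚ ℂ (fun x => IsAlgClosed.splits _) (a₀ : K)]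
    intro φ ψ h
    have h' : (φ : K →+* ℂ) = (ψ : K →+* ℂ) := hsep h
    exact AlgHom.coe_ringHom_injective h'
  have hx : x ∈ (IntermediateField.adjoin ℚ {(a₀ : K)}).toSubalgebra := by
    rw [hprim]; trivial
  rw [IntermediateField.adjoin_simple_toSubalgebra_of_isAlgebraic
      (Algebra.IsAlgebraic.isAlgebraic (R := ℚ) (a₀ : K)), Algebra.adjoin_singleton_eq_range_aeval] at hx
  obtain ⟨R, hR⟩ := hx
  exact ⟨R, hR⟩

/-- Evaluating a rational polynomial at `σ(a₀)` is applying `σ` to its value at `a₀`. [folklore] -/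
theorem eval₂_embedding_eq (σ : K →+* ℂ) (x : K) (R : Polynomial ℚ) :
    Polynomial.eval₂ (algebraMap ℚ ℂ) (σ x) R = σ (Polynomial.aeval x R) := by
  rw [← Polynomial.aeval_def]
  exact Polynomial.aeval_algHom_apply σ.toRatAlgHom x R

variable [IsCMField K] [IsGalois ℚ K]

/-- **The minimal polynomial of an integer `a₀` of a Galois CM field `K` separating the complex embeddings
is a Galois CM field polynomial of degree `[K:ℚ]`** in the sense of the record
(`HodgeTheory.IsGaloisCMFieldPoly`): monic, of degree `[K:ℚ] ≥ 2`, irreducible over `ℚ`, no real complex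
root (`K` is totally complex and `σ ↦ σ(a₀)` is injective), ONE `Q ∈ ℚ[T]` inducing complex conjugation on
every root (`c(a₀) = Q(a₀)` for the complex conjugation `c` of the CM field `K = ℚ(a₀)`, and
`σ ∘ c = conj ∘ σ` for every `σ`), and every root a `ℚ`-polynomial in every other (`K/ℚ` Galois: two
embeddings differ by an automorphism `g`, and `g(a₀) = R(a₀)`). [cite: Milne2020HodgeClassesAV, §3 (proof of Thm. 1: "Let F be a CM subfield of ℂ, Galois over ℚ")] -/
theorem isGaloisCMFieldPoly_minpoly (a₀ : 𝓞 K)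
    (hsep : Function.Injective fun σ : K →+* ℂ => σ (a₀ : K)) :
    IsGaloisCMFieldPoly (minpoly ℤ a₀) (Module.finrank ℚ K) := by
  obtain ⟨hPm, hPirr, hPe, hroot, -⟩ := minpoly_facts K a₀ hsep
  refine ⟨hPm, hPe, ?_, hPirr, ?_, ?_, ?_⟩
  · -- `2 ≤ [K:ℚ]`: `K` is totally complex, so `[K:ℚ] = 2 · #(complex places) > 0`
    have h1 := IsTotallyComplex.finrank (K := K)
    have h2 : 0 < Module.finrank ℚ K := Module.finrank_pos
    omega
  · -- no real root
    intro ρ hρ hconj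
    obtain ⟨σ, rfl⟩ := exists_embedding_of_root K a₀ hρ
    refine IsTotallyComplex.complexEmbedding_not_isReal σ (ComplexEmbedding.isReal_iff.mpr (hsep ?_))
    change ComplexEmbedding.conjugate σ (a₀ : K) = σ (a₀ : K)
    rw [ComplexEmbedding.conjugate_coe_eq]
    exact hconj
  · -- one rational polynomial inducing complex conjugation on all the roots
    obtain ⟨Q, hQ⟩ := exists_aeval_eq_of_separating K a₀ hsep (IsCMField.complexConj K (a₀ : K))
    refine ⟨Q, fun ρ hρ => ?_⟩
    obtain ⟨σ, rfl⟩ := exists_embedding_of_root K a₀ hρ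
    rw [eval₂_embedding_eq, hQ, IsCMField.complexEmbedding_complexConj]
  · -- Galois: every root is a rational polynomial in every other
    intro ρ ρ' hρ hρ'
    obtain ⟨σ, rfl⟩ := exists_embedding_of_root K a₀ hρ
    obtain ⟨σ', rfl⟩ := exists_embedding_of_root K a₀ hρ'
    obtain ⟨R, hR⟩ := exists_aeval_eq_of_separating K a₀ hsep ((galOf K σ σ') (a₀ : K))
    refine ⟨R, ?_⟩
    rw [eval₂_embedding_eq, hR]
    have h := congrArg (fun f : K →+* ℂ => f (a₀ : K)) (comp_galOf K σ σ')
    exact h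

end GaloisCMPoly

section WeilLines

variable (K : Type) [Field K] [NumberField K]
variable {J : Type} [Fintype J] (B : J → AbelianVariety ℂ) (act : ∀ j, 𝓞 K →+* End (B j))

/-- **`K`-Weil-line classes are Weil classes of `F = ℚ(a₀)` on the carriers of the record**: for the
diagonal action `act` of `𝓞_K` on `⨁ B` and any `a₀ ∈ 𝓞_K`, the space `weilLineClasses B act k`
lies in `weilClassesField (⨁ B) ψ P k`, `ψ = act(a₀)`, `P = minpoly_ℤ(a₀)` (`(x·𝟙 + y·ψ)^* = act(x + y a₀)^*`
acts on the `s`-line by `(x + y s(a₀))^k`; the inclusion inside `AndreProductForm.eq_zero_of_not_admissible`).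
[cite: MoonenZarhin1998WeilClasses, §1 (W_F ⊗ ℂ = ⊕_σ ⋀^r V_{ℂ,σ})] [cite: Milne2020HodgeClassesAV, §2 2.1] -/
theorem weilLineClasses_le_weilClassesField (a₀ : 𝓞 K) (k : ℕ) :
    weilLineClasses B act k ≤ weilClassesField (⨁ B) (diagHom K B act a₀) (minpoly ℤ a₀) k := by
  have hroot : ∀ σ : K →+* ℂ, Polynomial.eval₂ (Int.castRingHom ℂ) (σ (a₀ : K)) (minpoly ℤ a₀) = 0 := by
    intro σ
    have h1 : Polynomial.aeval (σ.toRatAlgHom (a₀ : K)) (minpoly ℚ (a₀ : K)) = 0 := by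
      rw [Polynomial.aeval_algHom_apply, minpoly.aeval, map_zero]
    have h2 : Polynomial.eval₂ (Int.castRingHom ℂ) (σ (a₀ : K)) (minpoly ℤ a₀) =
        Polynomial.aeval (σ (a₀ : K)) ((minpoly ℤ a₀).map (Int.castRingHom ℚ)) := by
      rw [Polynomial.aeval_def, Polynomial.eval₂_map]
      congr 1
    rw [h2, minpoly_int_map_eq]
    exact h1
  unfold weilLineClasses
  refine iSup_le fun s => ?_
  refine le_trans ?_ (pullbackEigenclasses_le_weilClassesField (hroot s))
  intro x hx
  rw [mem_pullbackEigenclasses_iff]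
  intro x' y'
  have hx' := (Submodule.mem_iInf _).mp hx ((x' : 𝓞 K) + (y' : 𝓞 K) * a₀)
  rw [Module.End.mem_eigenspace_iff] at hx'
  rw [nsmul_id_add_nsmul_diagHom]
  change (complexBetti.map (diagonalAction B act ((x' : 𝓞 K) + (y' : 𝓞 K) * a₀)).hom.hom.hom k).hom x = _
  rw [hx']
  congr 1
  simp

omit [NumberField K] in
/-- `P(ψ) = 0` in `End(⨁ B)` for `ψ = act(a₀)`, `P = minpoly_ℤ(a₀)`. [folklore] -/
theorem eval₂_diagHom_minpoly (a₀ : 𝓞 K) :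
    Polynomial.eval₂ (Int.castRingHom (CategoryTheory.End (⨁ B)))
      (diagHom K B act a₀ : CategoryTheory.End (⨁ B)) (minpoly ℤ a₀) = 0 := by
  have hPa₀ : Polynomial.eval₂ (Int.castRingHom (𝓞 K)) a₀ (minpoly ℤ a₀) = 0 := by
    have := minpoly.aeval ℤ a₀
    rwa [Polynomial.aeval_def, algebraMap_int_eq] at this
  change Polynomial.eval₂ _ (diagEnd K B act a₀) _ = 0
  rw [eval₂_diagEnd, hPa₀, map_zero]

end WeilLines

/-- **The assembly of Milne's proof from a domination datum.** If `A` is dominated by the product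
`∏_{j ≤ n} A_{(F,Θ_j)}` of chosen realisations of CM types of a Galois CM field `F` (`π ∘ s = [N]`), then for
ANY integer `a₀ ∈ 𝓞_F` every rational `(p,p)` class on `A` lies in the `ℂ`-span of
`weilClassPullbacksField A (minpoly_ℤ a₀) [F:ℚ] p`: André's product form on `⨁_j A_{(F,Θ_j)}` (the factors
read as `F`-realisations) applied to `π^* c`, pushed back by `s^*` (`s^* π^* c = N^{2p} c`), each generator
`f_Δ^* t` going to `(s ≫ f_Δ)^* t` with `t ∈ W_F ⊗ ℂ` of the twisted slot product (`ψ = act(a₀)`,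
`P = minpoly_ℤ a₀`, `[F:ℚ] · 2p = 2 dim`). [cite: Milne2020HodgeClassesAV, §3 Thm. 1 (proof)]
[cite: Andre1992HodgeCM, Théorème] -/
theorem milne2020_of_avDominatedBy (h₃ : CMAbelianVarietyRealised) {F : Type} [Field F] [NumberField F]
    [IsCMField F] [IsGalois ℚ F] {n : ℕ} (Θ : Fin (n + 1) → CMType F) {A : AbelianVariety ℂ}
    (hdom : AVDominatedBy A (cmProdAV F h₃ n Θ)) (a₀ : 𝓞 F) (p : ℕ) (c : complexBetti A.X (2 * p))
    (hcQ : IsRationalClass c) (hcH : IsOfHodgeType A.dim A.X (2 * p) p p c) :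
    c ∈ Submodule.span ℂ (weilClassPullbacksField A (minpoly ℤ a₀) (Module.finrank ℚ F) p) := by
  classical
  -- the factors, as realisations of CM types of `F` itself
  let A' : Fin (n + 1) → AbelianVariety ℂ := fun j => (cmRealisation h₃ (cmCode F (Θ j))).AV
  let eF : (j : Fin (n + 1)) → ((cmCode F (Θ j)).E ≃+* F) := fun j => (cmCodeEquiv F (Θ j)).symm
  let Ψ : Fin (n + 1) → CMType F := fun j => PicardCM.CMCode.cmTypeMap (eF j) (cmCode F (Θ j)).Φ
  let ι' : ∀ j, 𝓞 F →+* End (A' j) := fun j =>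
    (cmRealisation h₃ (cmCode F (Θ j))).ι.comp (RingOfIntegers.mapRingEquiv (eF j).symm).toRingHom
  let θ' : ∀ j, F →+* Module.End ℂ (complexBetti (A' j).X 1) := fun j =>
    (cmRealisation h₃ (cmCode F (Θ j))).θ.comp (eF j).symm.toRingHom
  have hA' : ∀ j, IsCMTypeRealisation (Ψ j) (A' j) (ι' j) (θ' j) := fun j =>
    (cmRealisation_isCMTypeRealisation h₃ (cmCode F (Θ j))).transport (eF j)
  have hdom' : AVDominatedBy A (⨁ A') := hdom.trans (cmProdAV_dominatedBy_biproduct F h₃ n Θ)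
  obtain ⟨s, π, N, hN, hsπ⟩ := hdom'
  -- André's product form on `⨁ A'` applied to `π^* c`
  have hc₁ := HodgeTheory.AbelianVariety.mapsTo_hodgeClasses π p ⟨hcQ, hcH⟩
  have handre := andre1992_hodgeClasses_cmTypedProduct_mem_span_pullback_weilLines_holds F (n + 1) A' Ψ ι' θ'
    hA' p (complexBetti.map π.hom.hom.hom (2 * p) c) hc₁.1 hc₁.2
  -- push through the domination: `s^* (π^* c) = N^{2p} • c`
  set L : complexBetti (⨁ A').X (2 * p) →ₗ[ℂ] complexBetti A.X (2 * p) :=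
    (complexBetti.map s.hom.hom.hom (2 * p)).hom with hL
  have hLc : L (complexBetti.map π.hom.hom.hom (2 * p) c) = ((N : ℂ) ^ (2 * p)) • c :=
    complexBetti_map_map_of_comp_eq_nsmul_id hsπ (2 * p) c
  have hmem := Submodule.apply_mem_span_image_of_mem_span L handre
  rw [hLc] at hmem
  have hNC : ((N : ℂ) ^ (2 * p)) ≠ 0 := pow_ne_zero _ (Nat.cast_ne_zero.mpr hN)
  rw [← inv_smul_smul₀ hNC c]
  refine Submodule.smul_mem _ _ (Submodule.span_mono ?_ hmem)
  -- the image of André's generators lies in the record's `weilClassPullbacksField`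
  rintro _ ⟨c', ⟨i, e, t, -, -, htQ, htH, htW, rfl⟩, rfl⟩
  let B : Fin (2 * p) → AbelianVariety ℂ := fun j => A' (i j)
  let act : ∀ j, 𝓞 F →+* End (B j) := fun j =>
    (ι' (i j)).comp (RingOfIntegers.mapRingEquiv (e j).symm).toRingHom
  refine ⟨⨁ B, (s ≫ multiDiagonal A' i).hom.hom.hom, diagHom F B act a₀, t,
    eval₂_diagHom_minpoly F B act a₀, ?_, weilLineClasses_le_weilClassesField F B act a₀ (2 * p) htW,
    htQ, htH, ?_⟩
  · -- `[F:ℚ] · 2p = 2 dim (⨁ B)` (eigenbases of the slots count `dim H¹`)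
    rw [two_mul_dim_biproduct B fun j => (exists_eigenbasis (hA' (i j))).choose, Fintype.card_fin,
      ← NumberField.Embeddings.card F ℂ, mul_comm]
  · -- `s^* (f_Δ^* t) = (s ≫ f_Δ)^* t`
    rw [complexBetti_map_comp_hom]
    rfl

/-- **Milne 2020, Theorem 1, modulo Riemann's theorem — the working form with the degree bound.** For
every complex abelian variety `A` of CM type there is ONE Galois CM field polynomial `P` of degree
`e ≥ 6` (the minimal polynomial of a separating integer of the common Galois CM field `F`, `[F:ℚ] ≥ 6`, of a
dominating product `∏_j A_{(F,Θ_j)}`) such that every rational `(p,p)` class on `A`, for every `p`, is a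
`ℂ`-combination of pull-backs `g^*(w)` of rational `(p,p)` classes `w ∈ weilClassesField B ψ P (2p)` with
`P(ψ) = 0`, `e · 2p = 2 dim B`. Milne's proof: «we may suppose `A` is a product» =
`Domination.cmDominated_of_isOfCMType_all_of_riemann` (with its degree bound), then
`milne2020_of_avDominatedBy`. [cite: Milne2020HodgeClassesAV, §3 Thm. 1 and its proof]
[cite: Andre1992HodgeCM, Théorème] [cite: DeligneMilne1982Tannakian, §6 Thm. 6.20 (Riemann)]
[cite: Shimura1998, §6.1 Cor. of Thm. 2, §6.2 Thm. 3] -/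
theorem milne2020_thm1_of_riemann_six_le (hR : DeligneMilne1982_Thm_6_20_full)
    (hU : BallQuotientUniformisedDatum) (h₃ : CMAbelianVarietyRealised) (A : AbelianVariety ℂ)
    (hCM : IsOfCMType A) :
    ∃ (P : Polynomial ℤ) (e : ℕ), IsGaloisCMFieldPoly P e ∧ 6 ≤ e ∧
      ∀ (p : ℕ) (c : complexBetti A.X (2 * p)), IsRationalClass c →
        IsOfHodgeType A.dim A.X (2 * p) p p c → c ∈ Submodule.span ℂ (weilClassPullbacksField A P e p) := by
  obtain ⟨F, _instF, _instNF, _instCM, hGal, h6, n, Θ, hdom⟩ :=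
    cmDominated_of_isOfCMType_all_of_riemann hR hU h₃ A hCM
  haveI : IsGalois ℚ F := hGal
  obtain ⟨a₀, hsep⟩ := exists_integer_separating F
  exact ⟨minpoly ℤ a₀, Module.finrank ℚ F, isGaloisCMFieldPoly_minpoly F a₀ hsep, h6,
    fun p c hcQ hcH => milne2020_of_avDominatedBy h₃ Θ hdom a₀ p c hcQ hcH⟩

/-- **Milne 2020, Theorem 1 (after Deligne 1982 §5 and André 1992), for EVERY complex abelian variety of
CM type — modulo Riemann's theorem `hR` (row B02) and the records `hU`, `h₃`**: the Literature record
`HodgeTheory.Milne2020_hodgeClasses_cmType_mem_span_pullback_weilClassesField_galois` HOLDS under these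
displayed binders (`milne2020_thm1_of_riemann_six_le`, forgetting the degree bound).
[cite: Milne2020HodgeClassesAV, §3 Thm. 1 and its proof] [cite: Andre1992HodgeCM, Théorème]
[cite: DeligneMilne1982Tannakian, §6 Thm. 6.20 (Riemann)] -/
theorem milne2020_thm1_of_riemann (hR : DeligneMilne1982_Thm_6_20_full) (hU : BallQuotientUniformisedDatum)
    (h₃ : CMAbelianVarietyRealised) :
    Milne2020_hodgeClasses_cmType_mem_span_pullback_weilClassesField_galois := fun A _ hCM =>
  let ⟨P, e, hP, _, h⟩ := milne2020_thm1_of_riemann_six_le hR hU h₃ A hCM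
  ⟨P, e, hP, h⟩

/-- The same on stage 1's record `h₁ : PicardCM.BallQuotientUniformised`. [cite: Milne2020HodgeClassesAV, §3 Thm. 1] -/
theorem milne2020_thm1_of_riemann' (hR : DeligneMilne1982_Thm_6_20_full) (h₁ : PicardCM.BallQuotientUniformised)
    (h₃ : CMAbelianVarietyRealised) :
    Milne2020_hodgeClasses_cmType_mem_span_pullback_weilClassesField_galois :=
  milne2020_thm1_of_riemann hR (PicardCM.ballQuotientUniformisedDatum_of h₁) h₃

/-- **Milne's hypothesis (H) for every complex abelian variety from the Weil classes of Galois CM fields,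
modulo Riemann's theorem.** Granted `hR`, `hU`, `h₃`: if for every Galois CM field polynomial `P`, every
`B` with `P(ψ) = 0`, `e · 2p = 2 dim B`, and every `p`, the rational `(p,p)` classes of
`weilClassesField B ψ P (2p)` are algebraic (binder `hW`, OPEN beyond the known cases), then
`Milne1999.CMHodgeHypothesisAt A` for every `A` (`cmHodgeHypothesisAt_of_milne2020`). [cite: Milne2020HodgeClassesAV, §3 Thm. 1]
[cite: Andre1992HodgeCM, p. 2 and Théorème] [cite: DeligneMilne1982Tannakian, §6 Thm. 6.20 (Riemann)] -/
theorem cmHodgeHypothesisAt_of_weilClassesField_galois_of_riemann (hR : DeligneMilne1982_Thm_6_20_full)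
    (hU : BallQuotientUniformisedDatum) (h₃ : CMAbelianVarietyRealised)
    (hW : ∀ (P : Polynomial ℤ) (e : ℕ), IsGaloisCMFieldPoly P e →
      ∀ (B : AbelianVariety ℂ) (ψ : B ⟶ B) (p : ℕ),
        Polynomial.eval₂ (Int.castRingHom (CategoryTheory.End B)) (ψ : CategoryTheory.End B) P = 0 →
        e * (2 * p) = 2 * B.dim →
          ∀ w ∈ weilClassesField B ψ P (2 * p), IsRationalClass w →
            IsOfHodgeType B.dim B.X (2 * p) p p w → w ∈ algebraicClasses B.X p)
    (A : AbelianVariety ℂ) : Milne1999.CMHodgeHypothesisAt A :=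
  cmHodgeHypothesisAt_of_milne2020 (milne2020_thm1_of_riemann hR hU h₃) hW A

/-- **`HC_CM` from the algebraicity of the Weil classes of Galois CM fields (every `F`-rank), modulo
Riemann's theorem and the records `hU`, `h₃`** — André's 1992 reduction as a kernel arrow of the cell
(`HC_CM = RankFourFaces.CMAbelianHodge` is `∀ A, Milne1999.CMHodgeHypothesisAt A` by `Iff.rfl`,
`hc_cm_iff_forall_cmHodgeHypothesisAt`). [cite: Milne2020HodgeClassesAV, §3 Thm. 1]
[cite: Andre1992HodgeCM, p. 2] [cite: Milne1999, §7 p. 72 (hypothesis (H))] -/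
theorem hc_cm_of_weilClassesField_galois_of_riemann (hR : DeligneMilne1982_Thm_6_20_full)
    (hU : BallQuotientUniformisedDatum) (h₃ : CMAbelianVarietyRealised)
    (hW : ∀ (P : Polynomial ℤ) (e : ℕ), IsGaloisCMFieldPoly P e →
      ∀ (B : AbelianVariety ℂ) (ψ : B ⟶ B) (p : ℕ),
        Polynomial.eval₂ (Int.castRingHom (CategoryTheory.End B)) (ψ : CategoryTheory.End B) P = 0 →
        e * (2 * p) = 2 * B.dim →
          ∀ w ∈ weilClassesField B ψ P (2 * p), IsRationalClass w →
            IsOfHodgeType B.dim B.X (2 * p) p p w → w ∈ algebraicClasses B.X p) :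
    HC_CM :=
  hc_cm_iff_forall_cmHodgeHypothesisAt.mpr
    (cmHodgeHypothesisAt_of_weilClassesField_galois_of_riemann hR hU h₃ hW)

/-- **`HC_CM` from the `F`-rank-FOUR Weil classes of Galois CM fields, modulo Riemann's theorem, the records
`hU`, `h₃`, and Hazama's codimension-two reduction** (record `Hazama2003_generalHodge_cmType_of_hodge_codimTwo`
= Milne, AIM talk, Thm. 8.5): the tree's `cmHodgeHypothesisAt_of_milne2020_of_rankFourWeilGalois` fed with
`milne2020_thm1_of_riemann`. [cite: Milne2020HodgeClassesAV, §3 Thm. 1]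
[cite: Milne2007TateFiniteFieldsAIM, Thm. 8.5] [cite: Hazama2003GHCCM, Thm. 8.3 p. 655] -/
theorem hc_cm_of_rankFourWeilClassesField_galois_of_riemann_of_hazama (hR : DeligneMilne1982_Thm_6_20_full)
    (hU : BallQuotientUniformisedDatum) (h₃ : CMAbelianVarietyRealised)
    (h83 : Hazama2003_generalHodge_cmType_of_hodge_codimTwo)
    (h₄ : ∀ (P : Polynomial ℤ) (e : ℕ), IsGaloisCMFieldPoly P e →
      ∀ (B : AbelianVariety ℂ) (ψ : B ⟶ B),
        Polynomial.eval₂ (Int.castRingHom (CategoryTheory.End B)) (ψ : CategoryTheory.End B) P = 0 →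
        e * (2 * 2) = 2 * B.dim →
          ∀ w ∈ weilClassesField B ψ P (2 * 2), IsRationalClass w →
            IsOfHodgeType B.dim B.X (2 * 2) 2 2 w → w ∈ algebraicClasses B.X 2) :
    HC_CM :=
  hc_cm_iff_forall_cmHodgeHypothesisAt.mpr
    (cmHodgeHypothesisAt_of_milne2020_of_rankFourWeilGalois (milne2020_thm1_of_riemann hR hU h₃) h83 h₄)

end Summit.HodgeConjecture.CorCM.Milne2020

end
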